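import Summits.QuantumFields.YangMills.Theorems.BalabanUVNodesN15TwoSpacingGluingCurvedKnitCovariantAveragingTransfer
import HarnessLib

/-!
# THE GLUING STEP AT TWO LATTICE SPACINGS — PROGRAMME (P-Q), VIIb: THE SIX ROWS OF FILE 123 FOR THE COVARIANT AVERAGING PERTURBATION `N_V^Q` (one grid: `hNVcut`∕`hNVcut′`∕`hfarN`∕`hfarN′`;
# two grids: `hDNV`∕`hDfarN`) in transporter-letter currency (`ρ, ρ₁`) and holonomy-fit currency (`Φ`)

Cell `pub-ymgap`, seat `pub-ymgap-dag-n15-c` (R134 (a); HUMAN RULING D-0062), generation 21.  `bears_on: R4∕N15 · K3⁸ SpineGivenEndpointR13SepCoPHV (stmt-QuantumFields-27366)`.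
Filed `--supports stmt-QuantumFields-27366 --as helper` — COUNT-NEUTRAL.  Theorems only; 0 `sorry`.  Imports BY NAME n15-c∕187a (`cvNVq'`, `idef_sandwich_pull`, `hasMaj_sandwich₂_of_abs_le_one`,
`liftBlk_blockOf_fine_eq`; through it 183 `cvNVq`, `cvT`, `hasMaj_sandwich_of_abs_le_one`, 186 `hasMaj_idef_nvQ`, 185a `rows∕cols_cvaPath_conj_sub_le`, 184a `kingPr_sub_mul_smul`, 182b `hasMaj_nvQ`).
Nothing in the tree is modified.

WHY.  FILE 123 (`uN_idef_cvGlued`) displays, for the nonlocal perturbations `N_V, N_V′` of the two knits, six rows.  For Bałaban's covariant averaging summand (n15-c∕183: `N_V := N_V^Q =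
a(Q*Q ⊗ 1 − Q*(U)Q(U))`, `N_V′ := N_V^Q′`) they all follow from two letters: the one-grid letter (n15-c∕182b `hasMaj_nvQ`, size `|a|K(2+K)·c_δe^{3δ}`, `K = (1+ρ)^{(d+2)n} − 1` from the
transporter letter `ρ`) and the two-grid letter (n15-c∕186 `hasMaj_idef_nvQ`, size `|a|c_δe^{3δ}(4∕n + (φ + 2(1+ρ)^{(d+2)n}∕n)(2 + K + K₁))` from the path-transport fit `φ`), once the cut-offs
are moved outside (`|ψ|, |χ|, |1 − ψ| ≤ 1` cost nothing; on the cover `χ′ = χ∘π̂`, `ψ′ = ψ∘π̂` — n15-c∕187a) and the fit `φ` is read off the holonomy fit `Φ` (n15-c∕185a: `φ = |ι|κ_e·2√m·√m·Φ`;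
the adjoint-shape fit is the forward fit at the shifted base point `x″ = x′ − (L^r s + j)e′_κ`, n15-c∕184a `kingPr_sub_mul_smul`).  THIS FILE writes the rows in that currency; the sequel plugs
FILE 130's small-field letters (`ρ = |ι|κ_e·2m·(e^{ηr_A} − 1)`, `Φ` = n15-c∕185c `norm_holPath_two_grid_le`) and runs FILE 123.

WHAT.
* §1 `cv_hasMaj_sandwich_cvNVq` (coarse one-grid rows, any cuts `|f|, |χ| ≤ 1`), `cv_hasMaj_sandwich_cvNVq'` (fine, in FILE 123's fine norm).
* §2 `cv_fit_of_hol` ∕ `cv_fitA_of_hol` (186's two fit hypotheses from a holonomy fit `Φ`), ★★ `cv_hasMaj_idef_sandwich_cvNVq` (the two-grid rows `hDNV`∕`hDfarN`, any cuts `|f|, |χ| ≤ 1`).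

HONEST FRAMING ∕ LIMITS.  Plumbing on MODEL carriers (doubled-torus cover); no estimate of Bałaban's.  NE2⁺ NOT PRINTED; N15 of record untouched (DISCHARGED AS CONSUMED); counts UNMOVED
(typed 28∕28); one finite 𝕋⁴ at fixed ε per index — NOT infinite volume ∕ OS ∕ mass gap ∕ Clay.  Restate-immune (no Theses import).
-/

noncomputable section

open scoped BigOperators Matrix

namespace Summit.QuantumFields.YangMills.BalabanUVNodes.N15.Gluing

open Real NormedSpace
open Literature.MathematicalPhysics.QuantumFieldTheory.Balaban1983to89
open Literature.MathematicalPhysics.QuantumFieldTheory.Balaban1983to89.B11SectG (BlockNorm HasMaj)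
open Literature.MathematicalPhysics.QuantumFieldTheory.Balaban1983to89.B6Prop26Gluing (mulOp mulOp_apply)
open Literature.MathematicalPhysics.QuantumFieldTheory.Balaban1983to89.B6UnitTorusCarrier (unitTorusGeo unitTorusGeo_dist)
open Literature.MathematicalPhysics.QuantumFieldTheory.Balaban1983to89.T4EtaRateDefect (idef)
open Literature.MathematicalPhysics.QuantumFieldTheory.Balaban1983to89.T4EtaRateCoeffDefect (pull)
open Literature.MathematicalPhysics.QuantumFieldTheory.Balaban1983to89.B5Prop11Plancherel (Tor fine unitVec)
open Literature.MathematicalPhysics.QuantumFieldTheory.King1986.Torus (blockOf tdistT)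
open Summit.QuantumFields.YangMills.BalabanUVNodes.N15.VectorPiece (tensorId kingPr kingPrV)
open Summit.QuantumFields.YangMills.BalabanUVNodes.N15.MatrixSpecies (coordMat basisConst basisConst_nonneg liftBlk liftMap)
open Summit.QuantumFields.YangMills.BalabanUVNodes.N15.TwoGrid (qvRe qvAdjRe)
open Summit.QuantumFields.YangMills.BalabanUVNodes.N15.CovAvg (cvaPath qvCov qvCovAdj holPath hasMaj_nvQ hasMaj_idef_nvQ rows_cvaPath_conj_sub_le cols_cvaPath_conj_sub_le kingPr_sub_mul_smul)

variable {d : ℕ}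

section Rows

open scoped Matrix.Norms.L2Operator

variable {L : ℕ} [NeZero L] {mm : Type} [Fintype mm] [DecidableEq mm] {ι : Type} [Fintype ι] [DecidableEq ι] (e : Matrix mm mm ℂ ≃L[ℝ] (ι → ℝ))
variable (mv kk r : ℕ) (hL : Odd L ∧ 1 < L) (a : ℝ)

/-! ## §1 The one-grid rows -/

/-- COARSE ONE-GRID ROWS (`hNVcut`, `hfarN` of FILE 123 for `N_V^Q`): for cuts `|f|, |χ| ≤ 1`, `M_f∘N_V^Q∘M_χ ≤ |a|K(2+K)·c_δe^{3δ}·e^{−δd}`, `K = (1+ρ)^{(d+2)L^k} − 1`.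
[cite: Balaban1985BackgroundPropagators, (3.26) p.395, (3.59)–(3.60) p.402 (mechanism)] -/
theorem cv_hasMaj_sandwich_cvNVq {U : Fin (d + 1) → CvX d L mv kk hL → Matrix mm mm ℂ} {ρ δ : ℝ} (hρ : 0 ≤ ρ) (hδ : 0 < δ)
    (hTr : ∀ μ p i, ∑ j, |(cvT e U μ p - 1) i j| ≤ ρ) (hTc : ∀ μ p j, ∑ i, |(cvT e U μ p - 1) i j| ≤ ρ)
    (f χ : CvX d L mv kk hL → ℝ) (hf : ∀ x, |f x| ≤ 1) (hχ : ∀ x, |χ x| ≤ 1) :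
    HasMaj (CvNorm d L mv kk hL ι) (CvNorm d L mv kk hL ι)
      (mulOp (fun p : CvX d L mv kk hL × ι => f p.1) ∘ₗ cvNVq d L mv kk hL a ι e U ∘ₗ mulOp (fun p : CvX d L mv kk hL × ι => χ p.1))
      (fun y y' => |a| * (((1 + ρ) ^ ((d + 2) * L ^ kk) - 1) * (2 + ((1 + ρ) ^ ((d + 2) * L ^ kk) - 1)) * (B4Sect5Proof.latticeConst (d + 1) δ * Real.exp (3 * δ))) *
        Real.exp (-(δ * (unitTorusGeo L kk (cvM d L mv kk hL)).dist y y'))) := by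
  have hNV := hasMaj_nvQ (L := L) (cvM d L mv kk hL) kk (L ^ kk) (T := cvT e U) hρ hδ hTr hTc a
  have hK : 0 ≤ (1 + ρ) ^ ((d + 2) * L ^ kk) - 1 := by have := one_le_pow₀ (M₀ := ℝ) (a := 1 + ρ) (by linarith) (n := (d + 2) * L ^ kk); linarith
  have hc0 : 0 ≤ B4Sect5Proof.latticeConst (d + 1) δ := B4Sect5Proof.latticeConst_nonneg (d + 1) hδ.le
  exact hasMaj_sandwich_of_abs_le_one (g := unitTorusGeo L kk (cvM d L mv kk hL)) (liftBlk (cvBlk d L mv kk hL) ι) (N := cvNVq d L mv kk hL a ι e U)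
    (K := fun y y' => |a| * (((1 + ρ) ^ ((d + 2) * L ^ kk) - 1) * (2 + ((1 + ρ) ^ ((d + 2) * L ^ kk) - 1)) * (B4Sect5Proof.latticeConst (d + 1) δ * Real.exp (3 * δ))) *
      Real.exp (-(δ * (unitTorusGeo L kk (cvM d L mv kk hL)).dist y y')))
    (ψ := fun p : CvX d L mv kk hL × ι => f p.1) (χ := fun p : CvX d L mv kk hL × ι => χ p.1) (fun p => hf p.1) (fun p => hχ p.1) (fun y y' => by positivity) hNV

/-- FINE ONE-GRID ROWS (`hNVcut′`, `hfarN′` of FILE 123 for `N_V^Q′`), in FILE 123's fine norm (blocks `cvBlk∘π̂`): `M_{f′}∘N_V^Q′∘M_{χ′} ≤ |a|K₁(2+K₁)·c_δe^{3δ}·e^{−δd}`, `K₁ = (1+ρ₁)^{(d+2)L^rL^k} − 1`.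
[cite: Balaban1985BackgroundPropagators, (3.26) p.395, (3.59)–(3.60) p.402 (mechanism)] -/
theorem cv_hasMaj_sandwich_cvNVq' {U' : Fin (d + 1) → CvX' d L mv kk r hL → Matrix mm mm ℂ} {ρ₁ δ : ℝ} (hρ₁ : 0 ≤ ρ₁) (hδ : 0 < δ)
    (hTr' : ∀ μ p i, ∑ j, |(cvT e U' μ p - 1) i j| ≤ ρ₁) (hTc' : ∀ μ p j, ∑ i, |(cvT e U' μ p - 1) i j| ≤ ρ₁)
    (f' χ' : CvX' d L mv kk r hL → ℝ) (hf : ∀ x', |f' x'| ≤ 1) (hχ : ∀ x', |χ' x'| ≤ 1) :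
    HasMaj (BlockNorm.ofBlocks (unitTorusGeo L kk (cvM d L mv kk hL)) (liftBlk (cvBlk d L mv kk hL ∘ kingPrV L kk r (cvM d L mv kk hL)) ι))
      (BlockNorm.ofBlocks (unitTorusGeo L kk (cvM d L mv kk hL)) (liftBlk (cvBlk d L mv kk hL ∘ kingPrV L kk r (cvM d L mv kk hL)) ι))
      (mulOp (fun p : CvX' d L mv kk r hL × ι => f' p.1) ∘ₗ cvNVq' d L mv kk r hL a ι e U' ∘ₗ mulOp (fun p : CvX' d L mv kk r hL × ι => χ' p.1))
      (fun y y' => |a| * (((1 + ρ₁) ^ ((d + 2) * (L ^ r * L ^ kk)) - 1) * (2 + ((1 + ρ₁) ^ ((d + 2) * (L ^ r * L ^ kk)) - 1)) * (B4Sect5Proof.latticeConst (d + 1) δ * Real.exp (3 * δ))) *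
        Real.exp (-(δ * (unitTorusGeo L kk (cvM d L mv kk hL)).dist y y'))) := by
  have hNV := hasMaj_nvQ (L := L) (cvM d L mv kk hL) kk (L ^ r * L ^ kk) (T := cvT e U') hρ₁ hδ hTr' hTc' a
  rw [liftBlk_blockOf_fine_eq (ι := ι) mv kk r hL] at hNV
  have hK : 0 ≤ (1 + ρ₁) ^ ((d + 2) * (L ^ r * L ^ kk)) - 1 := by
    have := one_le_pow₀ (M₀ := ℝ) (a := 1 + ρ₁) (by linarith) (n := (d + 2) * (L ^ r * L ^ kk)); linarith
  have hc0 : 0 ≤ B4Sect5Proof.latticeConst (d + 1) δ := B4Sect5Proof.latticeConst_nonneg (d + 1) hδ.le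
  exact hasMaj_sandwich_of_abs_le_one (g := unitTorusGeo L kk (cvM d L mv kk hL)) (liftBlk (cvBlk d L mv kk hL ∘ kingPrV L kk r (cvM d L mv kk hL)) ι) (N := cvNVq' d L mv kk r hL a ι e U')
    (K := fun y y' => |a| * (((1 + ρ₁) ^ ((d + 2) * (L ^ r * L ^ kk)) - 1) * (2 + ((1 + ρ₁) ^ ((d + 2) * (L ^ r * L ^ kk)) - 1)) * (B4Sect5Proof.latticeConst (d + 1) δ * Real.exp (3 * δ))) *
      Real.exp (-(δ * (unitTorusGeo L kk (cvM d L mv kk hL)).dist y y')))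
    (ψ := fun p : CvX' d L mv kk r hL × ι => f' p.1) (χ := fun p : CvX' d L mv kk r hL × ι => χ' p.1) (fun p => hf p.1) (fun p => hχ p.1) (fun y y' => by positivity) hNV

/-! ## §2 The two-grid rows -/

/-- 186's FORWARD FIT from a holonomy fit `Φ`: rows of `T′-path(x′, L^r s + j) − T-path(πx′, s + δ′)` ≤ `|ι|κ_e·2√m·(√m·Φ)` (n15-c∕185a `rows_cvaPath_conj_sub_le`).
[cite: Balaban1985Averaging, (124)–(125) p.36 (shape); King1986, p.664] -/
theorem cv_fit_of_hol {U : Fin (d + 1) → CvX d L mv kk hL → Matrix mm mm ℂ} {U' : Fin (d + 1) → CvX' d L mv kk r hL → Matrix mm mm ℂ} {Φ : ℝ}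
    (hUu : ∀ μ p, (U μ p)ᴴ * U μ p = 1) (hU'u : ∀ μ p, (U' μ p)ᴴ * U' μ p = 1)
    (hhol : ∀ (x' : Tor (fine (L ^ r * L ^ kk) (cvM d L mv kk hL))) (μ : Fin (d + 1)) (s j δ' : ℕ), s < L ^ kk → j < L ^ r → δ' ≤ 1 →
      kingPr L kk r (cvM d L mv kk hL) (x' + j • unitVec (fine (L ^ r * L ^ kk) (cvM d L mv kk hL)) μ) = kingPr L kk r (cvM d L mv kk hL) x' + δ' • unitVec (fine (L ^ kk) (cvM d L mv kk hL)) μ →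
      ‖holPath (cvM d L mv kk hL) (L ^ r * L ^ kk) U' (x', μ) (L ^ r * s + j) - holPath (cvM d L mv kk hL) (L ^ kk) U (kingPr L kk r (cvM d L mv kk hL) x', μ) (s + δ')‖ ≤ Φ)
    (x' : Tor (fine (L ^ r * L ^ kk) (cvM d L mv kk hL))) (μ : Fin (d + 1)) (s j δ' : ℕ) (hs : s < L ^ kk) (hj : j < L ^ r) (hδ' : δ' ≤ 1)
    (hπ : kingPr L kk r (cvM d L mv kk hL) (x' + j • unitVec (fine (L ^ r * L ^ kk) (cvM d L mv kk hL)) μ) = kingPr L kk r (cvM d L mv kk hL) x' + δ' • unitVec (fine (L ^ kk) (cvM d L mv kk hL)) μ) (i : ι) :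
    ∑ c, |(cvaPath (cvM d L mv kk hL) (L ^ r * L ^ kk) (cvT e U') (x', μ) (L ^ r * s + j) - cvaPath (cvM d L mv kk hL) (L ^ kk) (cvT e U) (kingPr L kk r (cvM d L mv kk hL) x', μ) (s + δ')) i c| ≤
      Fintype.card ι * (@basisConst ι _ (Matrix mm mm ℂ) Matrix.frobeniusNormedAddCommGroup Matrix.frobeniusNormedSpace e * (2 * Real.sqrt (Fintype.card mm)) * (Real.sqrt (Fintype.card mm) * Φ)) := by
  refine (rows_cvaPath_conj_sub_le e hU'u hUu (x', μ) (L ^ r * s + j) (kingPr L kk r (cvM d L mv kk hL) x', μ) (s + δ') i).trans ?_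
  have hκ := @basisConst_nonneg ι _ (Matrix mm mm ℂ) Matrix.frobeniusNormedAddCommGroup Matrix.frobeniusNormedSpace e
  have h := hhol x' μ s j δ' hs hj hδ' hπ
  gcongr

/-- 186's ADJOINT-SHAPE FIT from the same holonomy fit, at the shifted base point `x″ = x′ − (L^r s + j)e′_κ` (`π(x″ + je′) = πx″ + δ′e`, `πx″ = πx′ − (s+δ′)e`; n15-c∕184a `kingPr_sub_mul_smul`,
n15-c∕185a `cols_cvaPath_conj_sub_le`). [cite: Balaban1985Averaging, (124)–(125) p.36 (shape); King1986, p.664] -/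
theorem cv_fitA_of_hol {U : Fin (d + 1) → CvX d L mv kk hL → Matrix mm mm ℂ} {U' : Fin (d + 1) → CvX' d L mv kk r hL → Matrix mm mm ℂ} {Φ : ℝ}
    (hUu : ∀ μ p, (U μ p)ᴴ * U μ p = 1) (hU'u : ∀ μ p, (U' μ p)ᴴ * U' μ p = 1)
    (hhol : ∀ (x' : Tor (fine (L ^ r * L ^ kk) (cvM d L mv kk hL))) (μ : Fin (d + 1)) (s j δ' : ℕ), s < L ^ kk → j < L ^ r → δ' ≤ 1 →
      kingPr L kk r (cvM d L mv kk hL) (x' + j • unitVec (fine (L ^ r * L ^ kk) (cvM d L mv kk hL)) μ) = kingPr L kk r (cvM d L mv kk hL) x' + δ' • unitVec (fine (L ^ kk) (cvM d L mv kk hL)) μ →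
      ‖holPath (cvM d L mv kk hL) (L ^ r * L ^ kk) U' (x', μ) (L ^ r * s + j) - holPath (cvM d L mv kk hL) (L ^ kk) U (kingPr L kk r (cvM d L mv kk hL) x', μ) (s + δ')‖ ≤ Φ)
    (x' : Tor (fine (L ^ r * L ^ kk) (cvM d L mv kk hL))) (κ : Fin (d + 1)) (s j δ' : ℕ) (hs : s < L ^ kk) (hj : j < L ^ r) (hδ' : δ' ≤ 1)
    (hπ : kingPr L kk r (cvM d L mv kk hL) (x' - j • unitVec (fine (L ^ r * L ^ kk) (cvM d L mv kk hL)) κ) = kingPr L kk r (cvM d L mv kk hL) x' - δ' • unitVec (fine (L ^ kk) (cvM d L mv kk hL)) κ) (c : ι) :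
    ∑ i, |(cvaPath (cvM d L mv kk hL) (L ^ r * L ^ kk) (cvT e U') (x' - (L ^ r * s + j) • unitVec (fine (L ^ r * L ^ kk) (cvM d L mv kk hL)) κ, κ) (L ^ r * s + j) -
        cvaPath (cvM d L mv kk hL) (L ^ kk) (cvT e U) (kingPr L kk r (cvM d L mv kk hL) x' - (s + δ') • unitVec (fine (L ^ kk) (cvM d L mv kk hL)) κ, κ) (s + δ')) i c| ≤
      Fintype.card ι * (@basisConst ι _ (Matrix mm mm ℂ) Matrix.frobeniusNormedAddCommGroup Matrix.frobeniusNormedSpace e * (2 * Real.sqrt (Fintype.card mm)) * (Real.sqrt (Fintype.card mm) * Φ)) := by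
  set x'' : Tor (fine (L ^ r * L ^ kk) (cvM d L mv kk hL)) := x' - (L ^ r * s + j) • unitVec (fine (L ^ r * L ^ kk) (cvM d L mv kk hL)) κ with hx''
  have h1 : x'' + j • unitVec (fine (L ^ r * L ^ kk) (cvM d L mv kk hL)) κ = x' - (L ^ r * s) • unitVec (fine (L ^ r * L ^ kk) (cvM d L mv kk hL)) κ := by
    rw [hx'', add_smul]; abel
  have h2 : x'' = (x' - j • unitVec (fine (L ^ r * L ^ kk) (cvM d L mv kk hL)) κ) - (L ^ r * s) • unitVec (fine (L ^ r * L ^ kk) (cvM d L mv kk hL)) κ := by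
    rw [hx'', add_smul]; abel
  have hπ'' : kingPr L kk r (cvM d L mv kk hL) x'' = kingPr L kk r (cvM d L mv kk hL) x' - (s + δ') • unitVec (fine (L ^ kk) (cvM d L mv kk hL)) κ := by
    rw [h2, kingPr_sub_mul_smul, hπ, add_smul]; abel
  have hπfit : kingPr L kk r (cvM d L mv kk hL) (x'' + j • unitVec (fine (L ^ r * L ^ kk) (cvM d L mv kk hL)) κ) =
      kingPr L kk r (cvM d L mv kk hL) x'' + δ' • unitVec (fine (L ^ kk) (cvM d L mv kk hL)) κ := by
    rw [h1, kingPr_sub_mul_smul, hπ'', add_smul]; abel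
  have h := hhol x'' κ s j δ' hs hj hδ' hπfit
  rw [hπ''] at h
  rw [← hπ'']
  refine (cols_cvaPath_conj_sub_le e hU'u hUu (x'', κ) (L ^ r * s + j) (kingPr L kk r (cvM d L mv kk hL) x'', κ) (s + δ') c).trans ?_
  rw [hπ'']
  have hκ := @basisConst_nonneg ι _ (Matrix mm mm ℂ) Matrix.frobeniusNormedAddCommGroup Matrix.frobeniusNormedSpace e
  gcongr

/-- ★★ THE TWO-GRID ROWS (`hDNV`, `hDfarN` of FILE 123 for `N_V^Q`): for cuts `|f|, |χ| ≤ 1` read on the fine carrier through `π̂`,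
`idef P̂ P̂ (M_{f∘π̂}∘N_V^Q′∘M_{χ∘π̂}) (M_f∘N_V^Q∘M_χ) ≤ |a|·c_δe^{3δ}·(4∕L^k + (φ + 2(1+ρ)^{(d+2)L^k}∕L^k)(2 + K + K₁))·e^{−δd}`, `φ = |ι|κ_e·2√m·√m·Φ`.
[cite: Balaban1985BackgroundPropagators, (3.26) p.395, (3.76)–(3.77) p.406 (mechanism); King1986, (2.1) p.664] -/
theorem cv_hasMaj_idef_sandwich_cvNVq {U : Fin (d + 1) → CvX d L mv kk hL → Matrix mm mm ℂ} {U' : Fin (d + 1) → CvX' d L mv kk r hL → Matrix mm mm ℂ} {ρ ρ₁ Φ δ : ℝ}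
    (hρ : 0 ≤ ρ) (hρ₁ : 0 ≤ ρ₁) (hΦ : 0 ≤ Φ) (hδ : 0 < δ)
    (hTr : ∀ μ p i, ∑ j, |(cvT e U μ p - 1) i j| ≤ ρ) (hTc : ∀ μ p j, ∑ i, |(cvT e U μ p - 1) i j| ≤ ρ) (hTc' : ∀ μ p j, ∑ i, |(cvT e U' μ p - 1) i j| ≤ ρ₁)
    (hUu : ∀ μ p, (U μ p)ᴴ * U μ p = 1) (hU'u : ∀ μ p, (U' μ p)ᴴ * U' μ p = 1)
    (hhol : ∀ (x' : Tor (fine (L ^ r * L ^ kk) (cvM d L mv kk hL))) (μ : Fin (d + 1)) (s j δ' : ℕ), s < L ^ kk → j < L ^ r → δ' ≤ 1 →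
      kingPr L kk r (cvM d L mv kk hL) (x' + j • unitVec (fine (L ^ r * L ^ kk) (cvM d L mv kk hL)) μ) = kingPr L kk r (cvM d L mv kk hL) x' + δ' • unitVec (fine (L ^ kk) (cvM d L mv kk hL)) μ →
      ‖holPath (cvM d L mv kk hL) (L ^ r * L ^ kk) U' (x', μ) (L ^ r * s + j) - holPath (cvM d L mv kk hL) (L ^ kk) U (kingPr L kk r (cvM d L mv kk hL) x', μ) (s + δ')‖ ≤ Φ)
    (f χ : CvX d L mv kk hL → ℝ) (hf : ∀ x, |f x| ≤ 1) (hχ : ∀ x, |χ x| ≤ 1) :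
    HasMaj (CvNorm d L mv kk hL ι) (BlockNorm.ofBlocks (unitTorusGeo L kk (cvM d L mv kk hL)) (liftBlk (cvBlk d L mv kk hL ∘ kingPrV L kk r (cvM d L mv kk hL)) ι))
      (idef (pull (liftMap (kingPrV L kk r (cvM d L mv kk hL)) ι)) (pull (liftMap (kingPrV L kk r (cvM d L mv kk hL)) ι))
        (mulOp ((fun p : CvX d L mv kk hL × ι => f p.1) ∘ liftMap (kingPrV L kk r (cvM d L mv kk hL)) ι) ∘ₗ cvNVq' d L mv kk r hL a ι e U' ∘ₗ
          mulOp ((fun p : CvX d L mv kk hL × ι => χ p.1) ∘ liftMap (kingPrV L kk r (cvM d L mv kk hL)) ι))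
        (mulOp (fun p : CvX d L mv kk hL × ι => f p.1) ∘ₗ cvNVq d L mv kk hL a ι e U ∘ₗ mulOp (fun p : CvX d L mv kk hL × ι => χ p.1)))
      (fun y y' => |a| * (B4Sect5Proof.latticeConst (d + 1) δ * Real.exp (3 * δ)) *
        (4 / (L ^ kk : ℕ) + (Fintype.card ι * (@basisConst ι _ (Matrix mm mm ℂ) Matrix.frobeniusNormedAddCommGroup Matrix.frobeniusNormedSpace e * (2 * Real.sqrt (Fintype.card mm)) * (Real.sqrt (Fintype.card mm) * Φ)) +
          2 * ((1 + ρ) ^ ((d + 2) * L ^ kk)) / (L ^ kk : ℕ)) * (2 + ((1 + ρ) ^ ((d + 2) * L ^ kk) - 1) + ((1 + ρ₁) ^ ((d + 2) * (L ^ r * L ^ kk)) - 1))) *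
        Real.exp (-(δ * (unitTorusGeo L kk (cvM d L mv kk hL)).dist y y'))) := by
  have hκ := @basisConst_nonneg ι _ (Matrix mm mm ℂ) Matrix.frobeniusNormedAddCommGroup Matrix.frobeniusNormedSpace e
  have hφ : 0 ≤ Fintype.card ι * (@basisConst ι _ (Matrix mm mm ℂ) Matrix.frobeniusNormedAddCommGroup Matrix.frobeniusNormedSpace e * (2 * Real.sqrt (Fintype.card mm)) * (Real.sqrt (Fintype.card mm) * Φ)) := by
    positivity
  have h186 := hasMaj_idef_nvQ (L := L) (cvM d L mv kk hL) kk r (T := cvT e U) (T' := cvT e U') hρ hρ₁ hφ hδ hTr hTc hTc'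
    (fun x' μ s j δ' hs hj hδ' hπ i => cv_fit_of_hol e mv kk r hL hUu hU'u hhol x' μ s j δ' hs hj hδ' hπ i)
    (fun x' κ s j δ' hs hj hδ' hπ c => cv_fitA_of_hol e mv kk r hL hUu hU'u hhol x' κ s j δ' hs hj hδ' hπ c) a
  rw [liftBlk_blockOf_fine_eq (ι := ι) mv kk r hL] at h186
  have hK : 0 ≤ (1 + ρ) ^ ((d + 2) * L ^ kk) - 1 := by have := one_le_pow₀ (M₀ := ℝ) (a := 1 + ρ) (by linarith) (n := (d + 2) * L ^ kk); linarith
  have hK₁ : 0 ≤ (1 + ρ₁) ^ ((d + 2) * (L ^ r * L ^ kk)) - 1 := by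
    have := one_le_pow₀ (M₀ := ℝ) (a := 1 + ρ₁) (by linarith) (n := (d + 2) * (L ^ r * L ^ kk)); linarith
  have hc0 : 0 ≤ B4Sect5Proof.latticeConst (d + 1) δ := B4Sect5Proof.latticeConst_nonneg (d + 1) hδ.le
  have hB : 0 ≤ (1 + ρ) ^ ((d + 2) * L ^ kk) := by positivity
  rw [show cvNVq' d L mv kk r hL a ι e U' = a • (tensorId ι (qvAdjRe (cvM d L mv kk hL) (L ^ r * L ^ kk) ∘ₗ qvRe (cvM d L mv kk hL) (L ^ r * L ^ kk)) -
      qvCovAdj (cvM d L mv kk hL) (L ^ r * L ^ kk) (cvT e U') ∘ₗ qvCov (cvM d L mv kk hL) (L ^ r * L ^ kk) (cvT e U')) from rfl,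
    show cvNVq d L mv kk hL a ι e U = a • (tensorId ι (qvAdjRe (cvM d L mv kk hL) (L ^ kk) ∘ₗ qvRe (cvM d L mv kk hL) (L ^ kk)) -
      qvCovAdj (cvM d L mv kk hL) (L ^ kk) (cvT e U) ∘ₗ qvCov (cvM d L mv kk hL) (L ^ kk) (cvT e U)) from rfl, idef_sandwich_pull]
  exact hasMaj_sandwich₂_of_abs_le_one (g := unitTorusGeo L kk (cvM d L mv kk hL)) (liftBlk (cvBlk d L mv kk hL) ι) (liftBlk (cvBlk d L mv kk hL ∘ kingPrV L kk r (cvM d L mv kk hL)) ι)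
    (ψ' := (fun p : CvX d L mv kk hL × ι => f p.1) ∘ liftMap (kingPrV L kk r (cvM d L mv kk hL)) ι) (χ := fun p : CvX d L mv kk hL × ι => χ p.1)
    (fun p => hf _) (fun p => hχ p.1) (fun y y' => by rw [unitTorusGeo_dist]; positivity) (h186.mono fun y y' => by rw [unitTorusGeo_dist])

end Rows

end Summit.QuantumFields.YangMills.BalabanUVNodes.N15.Gluing

end
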